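import Summits.BirchSwinnertonDyer.BirchSwinnertonDyer.Theorems.PrintCFramBottomClassIndexLawFiveLeSelmerCountCoalignedOfLocal
import Summits.BirchSwinnertonDyer.BirchSwinnertonDyer.Theorems.PrintCFramBottomClassIndexLawFiveLeSelmerDevissageLocalCriterionPoint
import Summits.BirchSwinnertonDyer.BirchSwinnertonDyer.Theorems.PrintCFramBottomClassIndexLawFiveLeSelmerDevissageLocalCriterionIsogenyClass
import Literature.NumberTheory.EllipticCurves.LocalFixedPointsTwoDescentProofs
import Literature.NumberTheory.EllipticCurves.LocalTorsionCohomologyCoprime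
import Literature.NumberTheory.EllipticCurves.BSDSelmerProofs
import HarnessLib

/-!
# Route `PrintCFram`, crux C2 `BottomClassIndexLawFiveLe` (stmt-BirchSwinnertonDyer-20372), line
# `eisenstein-resource-bdp-line` (registry v21, stubs B1-level `stub_bsdp_of_level` / B1-sha `stub_bsdp_of_sha`):
# **THE LEVEL-0 BRANCH OF THE FIRST-ORDER SELMER CENSUS, CASE-FREE** — at LEVEL `0` (the generator is not `p`-divisible in
# `W(ℚ_p)`) the STRICT residual classes of a stable line inject into `Ш(W/ℚ)[p]`
# (cell `bsd-print-cfram`, width seat `bsd-line-cfram-p1-w2` g11; helper `--supports` 20372; 0 defs, 0 facts, 0 sorry)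

HONEST FRAMING. Nothing about BSD is proved here and no stub is closed. The census so far (w2 g9/g10, w4 g10, w6 g4, w7 g4, this seat):
EVEN-REGULAR ⟹ `Ш(W)[p] = 0`; CASE R ((LA) at `p`) ∧ EVEN-IRREGULAR ⟹ `Ш(W)[p] ≠ 0`. This file treats the remaining cell WITHOUT
a case hypothesis, using the registry's own LEVEL binder instead: if the generator `P` of `W(ℚ)/tors` has level `0` at `p`, then every
STRICT class of `Φ` (unramified outside `p`, locally trivial at `p`) gives a non-zero element of `Ш(W/ℚ)[p]`:

  `ι_*[w] ∈ Sel_p(W/ℚ)` with NO alignment hypothesis (a class locally trivial at `p` lies in `L_p`; elsewhere as in w2 g10's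
  `incl_mem_selmerGroup_of_coaligned`), and `ι_*[w] ↦ 0` in `H¹(ℚ, W)` is impossible for `[w] ≠ 0`: a bounding point `R ∈ W(ℚ̄)` has
  `p•R =: P' ∈ W(ℚ)` and `R − s` fixed by `D_p` (strictness), so `P'` is `p`-divisible in `W(ℚ_p)`; writing `P' = k•P + p•T'` (torsion is
  `p`-divisible), LEVEL `0` forces `p ∣ k`, so `P' ∈ p•W(ℚ)` and `ι∘w` is the coboundary of an algebraic `p`-torsion point.

* §1 **`exists_geomTorsion_boundary_of_strict_of_level_zero`** — the cocycle lemma just described (any `W/ℚ`, any stable `Φ`).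
* §2 **`natCard_strict_le_natCard_sha_of_level_zero`** — `#R_str(Φ) ≤ #(Ш(W) ⊓ H¹(ℚ,W)[p])` (`R_str(Φ) = h1Unramified Φ.Sub S_p ⊓ ker res_{D_p}`):
  `[w] ↦ T(ι_*[w])`, `T : H¹(ℚ, W[p]) → H¹(ℚ, W)`, is injective by §1 (`ι_*` injective as `Φ.Quot^{Γ_ℚ} = 0`), lands in `Ш[p]` by
  Silverman X.4.2(a) (`map_torsionH1ToH1_selmerGroup`).
* §3 **`exists_sha_ne_zero_of_level_zero_of_prime_le_strict_of_cmRamified`** — on the CM-ramified class (`W(ℚ)[p] = 0`, bad places,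
  `Φ.Quot^Γ = 0`, torsion `p`-divisible — all landed): level `0` ∧ `p ≤ #R_str(Φ)` ⟹ `∃ c ∈ Ш(W/ℚ), c ≠ 0 ∧ p • c = 0`.

READING (B1): with `Φ = 𝔽_p(ψ)` the odd line and `#R_str(ψ) ≥ #R_rel(ψ)/p ≥ p` on EVEN-IRREGULAR members (reflection supply p684559 +
the local count `#H¹(ℚ_p, 𝔽_p(ψ)) = p`), this says: **EVEN-IRREGULAR ∧ LEVEL 0 ⟹ `Ш(W)[p] ≠ 0`**, i.e. every even-irregular rank-one member
lies in the premise of `stub_bsdp_of_level` (level `≥ 1`) or of `stub_bsdp_of_sha` (`Ш[p] ≠ 0`). THEOREMS ONLY; no definition, no named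
fact, no `sorry`. BSD is not proved by any of this; no summit statement is proved by this seat. References: [SilvermanAEC2009] VIII.§2,
X.§4 (Thm. 4.2); [MilneADT2006] I.§6; [SerreGaloisCohomology1997] I.§5; seat notes w2g9–w2g11, w6g4.
-/

set_option autoImplicit false
-- `…BirchSwinnertonDyer.BirchSwinnertonDyer.Theorems…` is the problem's mandated namespace (D-0017).
set_option linter.dupNamespace false

noncomputable section

open scoped Classical

namespace Summit.BirchSwinnertonDyer.BirchSwinnertonDyer.Theorems.PrintCFram.SelmerCount

open NumberField IsDedekindDomain Field WeierstrassCurve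
open Literature.NumberTheory.EllipticCurves Literature.NumberTheory.GaloisRepresentations
  Literature.NumberTheory.EllipticCurves.GreenbergSelmer Literature.NumberTheory.EllipticCurves.Rank1Residual
open Summit.BirchSwinnertonDyer.BirchSwinnertonDyer.Theorems.PrintCFram.LevelDictionary
open Summit.BirchSwinnertonDyer.Rank1Residual.X2.ResidualDevissageModules

/-! ## §1 The cocycle lemma: at level `0`, a strict `Φ`-class dying in `H¹(ℚ, W)` is zero -/

section Cocycle

variable (W : WeierstrassCurve ℚ) [W.IsElliptic]
variable {p : ℕ} [hp : Fact p.Prime] (v : HeightOneSpectrum (𝓞 ℚ))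
  (Φ : StableSubgroup (absoluteGaloisGroup ℚ) (geomTorsion W (p : ℤ)))

omit [W.IsElliptic] in
/-- **At LEVEL `0`, a STRICT `Φ`-valued cocycle which bounds in `W(ℚ̄)` bounds in `W[p]`.** `W/ℚ` elliptic, `v` a finite place,
`Φ ≤ W[p]` stable; `P ∈ W(ℚ)` with `W(ℚ) = ℤ•P + torsion`, every torsion point `p`-divisible in `W(ℚ)`, and `P` of LEVEL `0` at `v`
(`p • S ≠ P` for all `S ∈ W(ℚ_v)`); `w : Γ_ℚ → Φ` a continuous crossed homomorphism which is PRINCIPAL on the decomposition group `D_v`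
and whose push-forward to `W(ℚ̄)` is principal (`ι w(g) = g•R − R`). THEN `ι∘w` is already the coboundary of a point of `W[p]`.
Proof: `p•R` is `Γ_ℚ`-fixed (`ι w(g) ∈ W[p]`), so `p•R = P' ∈ W(ℚ)`; `R − ι s` is `D_v`-fixed, so its image in `W(\bar ℚ_v)` is a
`ℚ_v`-point `S` with `p•S = P'`; `P' = k•P + p•T'` and level `0` force `p ∣ k`; then `P' = p•P''`, `P'' ∈ W(ℚ)`, and
`t = R − P'' ∈ W[p]` bounds `ι∘w`. [cite: SilvermanAEC2009, VIII.§2 (Kummer pairing, Prop. 2.1 proof) and X.§4] -/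
theorem exists_geomTorsion_boundary_of_strict_of_level_zero (P : W.toAffine.Point)
    (hgen : ∀ R : W.toAffine.Point, ∃ (k : ℤ) (T : W.toAffine.Point), IsOfFinAddOrder T ∧ R = k • P + T)
    (htorsdiv : ∀ T : W.toAffine.Point, IsOfFinAddOrder T → ∃ T' : W.toAffine.Point, T = p • T')
    (hlev : ∀ S : (W.baseChange (v.adicCompletion ℚ)).toAffine.Point,
      p • S ≠ Affine.Point.baseChange (W' := W) ℚ (v.adicCompletion ℚ) P)
    (w : contOneCocycles (discreteTopRep (absoluteGaloisGroup ℚ) Φ.Sub))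
    (hstr : ∃ s : Φ.Sub, ∀ τ ∈ decomp v, w.1 τ = τ • s - s)
    (hR : ∃ R : geomPoints W, ∀ g : absoluteGaloisGroup ℚ,
      ((Φ.incl (w.1 g) : geomTorsion W (p : ℤ)) : geomPoints W) = g • R - R) :
    ∃ t : geomTorsion W (p : ℤ), ∀ g : absoluteGaloisGroup ℚ, Φ.incl (w.1 g) = g • t - t := by
  obtain ⟨s, hs⟩ := hstr
  obtain ⟨R, hR⟩ := hR
  have hpr := hp.out
  -- the values of `ι∘w` are `p`-torsion
  have htor : ∀ g : absoluteGaloisGroup ℚ,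
      (p : ℤ) • (((Φ.incl (w.1 g) : geomTorsion W (p : ℤ)) : geomPoints W)) = 0 := fun g =>
    (WeierstrassCurve.mem_geomTorsion_iff W (p : ℤ) _).mp (Φ.incl (w.1 g)).2
  -- `p • R` is fixed by `Γ_ℚ`, hence rational: `p • R = P'`
  have hfix : ∀ g : absoluteGaloisGroup ℚ, g • ((p : ℤ) • R) = (p : ℤ) • R := by
    intro g
    have h1 : g • R = (((Φ.incl (w.1 g) : geomTorsion W (p : ℤ)) : geomPoints W)) + R := by
      rw [hR g, sub_add_cancel]
    rw [WeierstrassCurve.smul_zsmul_geomPoints, h1, smul_add, htor g, zero_add]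
  obtain ⟨P', hP'⟩ := WeierstrassCurve.exists_toGeomPoints_eq_of_forall_smul_eq W hfix
  -- `R₁ = R − ι s` is fixed by `D_v`
  set ιs : geomPoints W := ((Φ.incl s : geomTorsion W (p : ℤ)) : geomPoints W) with hιs
  have hR₁ : ∀ τ ∈ decomp v, τ • (R - ιs) = R - ιs := by
    intro τ hτ
    have h1 := hR τ
    rw [hs τ hτ, map_sub, Φ.incl_smul, AddSubgroupClass.coe_sub,
      Literature.NumberTheory.EllipticCurves.AddSubgroup.torsionBy.coe_smul] at h1
    -- h1 : τ • ιs - ιs = τ • R - R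
    calc τ • (R - ιs) = (τ • R - R) - (τ • ιs - ιs) + (R - ιs) := by rw [smul_sub]; abel
      _ = R - ιs := by rw [← h1, sub_self, zero_add]
  have hpR₁ : (p : ℤ) • (R - ιs) = WeierstrassCurve.toGeomPoints W P' := by
    rw [smul_sub, hιs, (WeierstrassCurve.mem_geomTorsion_iff W (p : ℤ) _).mp (Φ.incl s).2, sub_zero, hP']
  -- the image of `R₁` in `W(\bar ℚ_v)` is a `ℚ_v`-point `S` with `p • S = P'`
  set y : localPoints W (v.adicCompletion ℚ) := pointsMap W (v.adicCompletion ℚ) (R - ιs) with hy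
  have hyfix : ∀ σ : absoluteGaloisGroup (v.adicCompletion ℚ), σ • y = y := by
    intro σ
    have hmem : resGal (K := ℚ) (v.adicCompletion ℚ) σ ∈ decomp v := by
      rw [WeierstrassCurve.resGal_eq_absGaloisRestrict]; exact ⟨σ, rfl⟩
    rw [hy, ← pointsMap_smul, hR₁ _ hmem]
  obtain ⟨S, hS⟩ := @exists_map_eq_of_forall_smul_eq_self ℚ _ W (v.adicCompletion ℚ) _ _
    (charZero_adicCompletion v) y hyfix
  set bc := Affine.Point.baseChange (W' := W) ℚ (v.adicCompletion ℚ) with hbc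
  have hpS : p • S = bc P' := by
    apply Affine.Point.map_injective (W' := W)
      (f := IsScalarTower.toAlgHom ℚ (v.adicCompletion ℚ) (AlgebraicClosure (v.adicCompletion ℚ)))
    have e1 := map_toAlgHom_baseChange_eq_pointsMap W (v.adicCompletion ℚ) P'
    have e3 : p • y = pointsMap W (v.adicCompletion ℚ) (WeierstrassCurve.toGeomPoints W P') := by
      rw [hy, ← map_nsmul, ← natCast_zsmul, hpR₁]
    rw [map_nsmul, hS]
    exact e3.trans e1.symm
  -- decompose `P' = k • P + p • T'`; level `0` forces `p ∣ k`
  obtain ⟨k, T, hT, hP'k⟩ := hgen P'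
  obtain ⟨T', rfl⟩ := htorsdiv T hT
  set bP := bc P with hbP
  set bT := bc T' with hbT
  have hpS' : (p : ℤ) • S = k • bP + p • bT := by
    rw [natCast_zsmul, hpS, hP'k]
    exact (map_add bc _ _).trans (congrArg₂ (· + ·) (map_zsmul bc k P) (map_nsmul bc p T'))
  have h1 : (p : ℤ) • (S - bT) = k • bP := by
    rw [zsmul_sub, hpS', natCast_zsmul, add_sub_cancel_right]
  have hk : (p : ℤ) ∣ k := by
    by_contra hk
    have hcop : IsCoprime ((p : ℕ) : ℤ) k := by
      rw [Int.isCoprime_iff_gcd_eq_one, Int.gcd_eq_natAbs, Int.natAbs_natCast]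
      exact (Nat.Prime.coprime_iff_not_dvd hpr).2 fun h => hk (Int.natCast_dvd.2 h)
    obtain ⟨a, b, hab⟩ := hcop
    have hab' : (p : ℤ) * a + b * k = 1 := by rw [mul_comm]; exact hab
    apply hlev (a • bP + b • (S - bT))
    rw [← natCast_zsmul, zsmul_add, smul_smul, smul_smul, mul_comm ((p : ℕ) : ℤ) b, ← smul_smul b, h1, smul_smul,
      ← add_zsmul, hab', one_zsmul]
  obtain ⟨k₀, rfl⟩ := hk
  -- `P' = p • P''` with `P'' ∈ W(ℚ)`
  set P'' : W.toAffine.Point := k₀ • P + T' with hP''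
  have hpP'' : (p : ℤ) • P'' = P' := by
    rw [hP'k, hP'', zsmul_add, smul_smul, natCast_zsmul]
  have hpP''n : p • P'' = P' := by rw [← natCast_zsmul]; exact hpP''
  -- `t = R − P''` is `p`-torsion and bounds `ι∘w`
  refine ⟨⟨R - WeierstrassCurve.toGeomPoints W P'', (WeierstrassCurve.mem_geomTorsion_iff W (p : ℤ) _).mpr ?_⟩,
    fun g => ?_⟩
  · rw [zsmul_sub, ← hP', ← hpP''n, toGeomPoints_nsmul_rat, natCast_zsmul, sub_self]
  · apply Subtype.ext
    rw [AddSubgroupClass.coe_sub, Literature.NumberTheory.EllipticCurves.AddSubgroup.torsionBy.coe_smul, hR g]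
    change g • R - R = g • (R - WeierstrassCurve.toGeomPoints W P'') - (R - WeierstrassCurve.toGeomPoints W P'')
    rw [smul_sub, WeierstrassCurve.smul_toGeomPoints]
    abel

end Cocycle

/-! ## §2 At level `0` the strict residual classes inject into `Ш(W/ℚ)[p]` -/

section Inject

variable (W : WeierstrassCurve ℚ) [W.IsElliptic]
variable {p : ℕ} [hp : Fact p.Prime]
  (Φ : StableSubgroup (absoluteGaloisGroup ℚ) (geomTorsion W (p : ℤ)))

/-- **AT LEVEL `0`, `R_str(Φ) ↪ Ш(W/ℚ)[p]` — no alignment hypothesis.** `W/ℚ` elliptic, `p` odd, `v ∋ p`; `Φ ≤ W[p]` stable with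
`Φ.Quot^{Γ_ℚ} = 0`; `W(ℚ_ℓ)[p] = 0` at the bad `ℓ ≠ p`; `P ∈ W(ℚ)` with `W(ℚ) = ℤ•P + torsion`, torsion `p`-divisible, `P` of LEVEL `0`
at `v`. THEN `#(h1Unramified Φ.Sub S_p ⊓ ker res_{D_p}) ≤ #T(Sel_p(W/ℚ))` where `T : H¹(ℚ, W[p]) → H¹(ℚ, W)` (so the right side is
`#(Ш(W) ∩ H¹(ℚ,W)[p])` by Silverman X.4.2(a)): `[w] ↦ T(ι_*[w])` — `ι_*[w]` is a Selmer class (strict at `p` ⟹ locally trivial at `p`;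
unramified at good `ℓ ≠ p`; bad `ℓ ≠ p` empty condition), and `T(ι_*[w]) = 0 ⟹ ι_*[w] = 0` (§1) `⟹ [w] = 0` (`H⁰(Γ, Φ.Quot) = 0`).
[cite: SilvermanAEC2009, Thm. X.4.2 (a)] [cite: MilneADT2006, Ch. I Prop. 3.8 and §6] -/
theorem natCard_strict_le_natCard_map_selmerGroup_of_level_zero (hp2 : p ≠ 2)
    (hQΓ : ∀ q : Φ.Quot, (∀ g : absoluteGaloisGroup ℚ, g • q = q) → q = 0)
    (hbad : ∀ v' : HeightOneSpectrum (𝓞 ℚ), ¬ W.HasGoodReductionAt v' → ((p : ℕ) : 𝓞 ℚ) ∉ v'.asIdeal →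
      ∀ Q : (W.baseChange (v'.adicCompletion ℚ)).toAffine.Point, p • Q = 0 → Q = 0)
    {v : HeightOneSpectrum (𝓞 ℚ)} (hpv : ((p : ℕ) : 𝓞 ℚ) ∈ v.asIdeal)
    (P : W.toAffine.Point)
    (hgen : ∀ R : W.toAffine.Point, ∃ (k : ℤ) (T : W.toAffine.Point), IsOfFinAddOrder T ∧ R = k • P + T)
    (htorsdiv : ∀ T : W.toAffine.Point, IsOfFinAddOrder T → ∃ T' : W.toAffine.Point, T = p • T')
    (hlev : ∀ S : (W.baseChange (v.adicCompletion ℚ)).toAffine.Point,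
      p • S ≠ Affine.Point.baseChange (W' := W) ℚ (v.adicCompletion ℚ) P)
    [Finite ↥((selmerGroup W (p : ℤ)).map (W.torsionH1ToH1 (p : ℤ)))] :
    Nat.card ↥(h1Unramified Φ.Sub {v' : HeightOneSpectrum (𝓞 ℚ) | ((p : ℕ) : 𝓞 ℚ) ∈ v'.asIdeal} ⊓
        subgroupResKer Φ.Sub (decomp v)) ≤
      Nat.card ↥((selmerGroup W (p : ℤ)).map (W.torsionH1ToH1 (p : ℤ))) := by
  have hp0 : ((p : ℕ) : ℤ) ≠ 0 := by exact_mod_cast hp.out.ne_zero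
  set Γ := absoluteGaloisGroup ℚ
  set Sp : Set (HeightOneSpectrum (𝓞 ℚ)) := {v' | ((p : ℕ) : 𝓞 ℚ) ∈ v'.asIdeal} with hSp
  -- `ι_* = H¹(Φ.incl)` and `T = H¹(W[p] ↪ W)`
  let ιH : discreteH1 Γ Φ.Sub →+ galH1Torsion W (p : ℤ) :=
    (ContinuousCohomology.map (ContinuousMonoidHom.id Γ)
      (resHomOfEquivariant (ContinuousMonoidHom.id Γ) Φ.incl Φ.incl_smul) 1).hom.toLinearMap.toAddMonoidHom
  have hιH : ∀ w, ιH (oneCocycleClass _ w) = oneCocycleClass (discreteTopRep Γ (geomTorsion W (p : ℤ)))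
      (contOneCocycles.pullback (ContinuousMonoidHom.id Γ)
        (resHomOfEquivariant (ContinuousMonoidHom.id Γ) Φ.incl Φ.incl_smul) w) := fun w ↦
    map_oneCocycleClass _ _ _ w
  have hT : ∀ z, W.torsionH1ToH1 (p : ℤ) (oneCocycleClass _ z) = oneCocycleClass (discreteTopRep Γ (geomPoints W))
      (contOneCocycles.pullback (ContinuousMonoidHom.id Γ)
        (resHomOfEquivariant (ContinuousMonoidHom.id Γ) (geomTorsion W (p : ℤ)).subtype (fun _ _ ↦ rfl)) z) := fun z ↦
    map_oneCocycleClass _ _ _ z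
  -- the unique place above `p`
  have hvv : ∀ v' : HeightOneSpectrum (𝓞 ℚ), ((p : ℕ) : 𝓞 ℚ) ∈ v'.asIdeal → v' = v := fun v' hv' ↦
    Rat.HeightOneSpectrum.primesEquiv.injective (Subtype.ext
      ((LevelDictionary.primesEquiv_eq_of_natCast_mem v' hp.out hv').trans
        (LevelDictionary.primesEquiv_eq_of_natCast_mem v hp.out hpv).symm))
  -- `ι_*` maps `R_str(Φ.Sub)` into `Sel_p`
  have hmem : ∀ c ∈ h1Unramified Φ.Sub Sp ⊓ subgroupResKer Φ.Sub (decomp v), ιH c ∈ selmerGroup W (p : ℤ) := by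
    intro c hc
    obtain ⟨hcU, hcD⟩ := AddSubgroup.mem_inf.mp hc
    obtain ⟨w, rfl⟩ := oneCocycleClass_surjective _ c
    rw [hιH]
    refine incl_mem_selmerGroup_of_coaligned W p hp2 Φ hbad w (fun v' 𝔓 hpv' h𝔓 ↦ ?_) (fun v' hpv' ↦ ?_)
    · have h := mem_h1Unramified_iff.1 hcU v' (by simpa [hSp] using hpv') 𝔓 h𝔓
      obtain ⟨s, hs⟩ := (oneCocycleClass_mem_subgroupResKer_iff _ w).1 h
      exact ⟨s, fun g hg ↦ hs ⟨g, hg⟩⟩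
    · -- strict at `p`: the restriction to `Γ_{ℚ_v}` is a coboundary, hence in `L_p`
      obtain rfl := hvv v' hpv'
      obtain ⟨s, hs⟩ := (oneCocycleClass_mem_subgroupResKer_iff _ w).1 hcD
      refine mem_selmerLocalKer_of_res_torsionGaloisModule_eq_zero W (v'.adicCompletion ℚ) _ ?_
      rw [WeierstrassCurve.res_torsionGaloisModule_oneCocycleClass]
      refine (oneCocycleClass_eq_zero_iff _ _).mpr ⟨Φ.incl s, fun σ ↦ ?_⟩
      have hσ : absGaloisRestrict ℚ (v'.adicCompletion ℚ) σ ∈ decomp v' := ⟨σ, rfl⟩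
      have h1 : Φ.incl (w.1 (absGaloisRestrict ℚ (v'.adicCompletion ℚ) σ)) =
          absGaloisRestrict ℚ (v'.adicCompletion ℚ) σ • Φ.incl s - Φ.incl s := by
        rw [hs ⟨_, hσ⟩, map_sub, Φ.incl_smul]
      exact h1
  -- injectivity of `ι_*` (`H⁰(Γ, Φ.Quot) = 0`)
  have hker : ∀ m : geomTorsion W (p : ℤ), Φ.proj m = 0 → ∃ s : Φ.Sub, Φ.incl s = m := fun m hm ↦
    ⟨⟨m, (QuotientAddGroup.eq_zero_iff m).mp hm⟩, rfl⟩
  have hπι : ∀ s : Φ.Sub, Φ.proj (Φ.incl s) = 0 := fun s ↦ (QuotientAddGroup.eq_zero_iff _).mpr s.2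
  -- the map `[w] ↦ T(ι_*[w])` and its injectivity (§1)
  let F : ↥(h1Unramified Φ.Sub Sp ⊓ subgroupResKer Φ.Sub (decomp v)) →
      ↥((selmerGroup W (p : ℤ)).map (W.torsionH1ToH1 (p : ℤ))) := fun c ↦
    ⟨W.torsionH1ToH1 (p : ℤ) (ιH c.1), AddSubgroup.mem_map_of_mem _ (hmem c.1 c.2)⟩
  have hF0 : ∀ c ∈ h1Unramified Φ.Sub Sp ⊓ subgroupResKer Φ.Sub (decomp v),
      W.torsionH1ToH1 (p : ℤ) (ιH c) = 0 → c = 0 := by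
    intro c hc h0
    obtain ⟨-, hcD⟩ := AddSubgroup.mem_inf.mp hc
    obtain ⟨w, rfl⟩ := oneCocycleClass_surjective _ c
    obtain ⟨s, hs⟩ := (oneCocycleClass_mem_subgroupResKer_iff _ w).1 hcD
    rw [hιH, hT, oneCocycleClass_eq_zero_iff] at h0
    obtain ⟨R, hR⟩ := h0
    obtain ⟨t, ht⟩ := exists_geomTorsion_boundary_of_strict_of_level_zero W v Φ P hgen htorsdiv hlev w
      ⟨s, fun τ hτ ↦ hs ⟨τ, hτ⟩⟩ ⟨R, fun g ↦ hR g⟩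
    obtain ⟨s₀, hs₀⟩ := exists_eq_smul_sub_of_push_principal Φ.incl Φ.proj Φ.incl_smul Φ.proj_smul
      Φ.incl_injective hπι hker hQΓ w.1 (m₀ := t) (fun g ↦ ht g)
    exact (oneCocycleClass_eq_zero_iff _ w).2 ⟨s₀, hs₀⟩
  refine Nat.card_le_card_of_injective F fun x y hxy ↦ ?_
  simp only [F, Subtype.mk.injEq] at hxy
  have h0 : W.torsionH1ToH1 (p : ℤ) (ιH (x.1 - y.1)) = 0 := by rw [map_sub, map_sub, hxy, sub_self]
  exact Subtype.ext (sub_eq_zero.1 (hF0 _ (AddSubgroup.sub_mem _ x.2 y.2) h0))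

end Inject

/-! ## §3 On the CM-ramified class: LEVEL `0` ∧ `#R_str(Φ) ≥ p` ⟹ `Ш(W/ℚ)[p] ≠ 0` -/

section Class

variable (W : WeierstrassCurve ℚ) [W.IsElliptic] [W.IsGloballyMinimal]
variable {p : ℕ} [hp : Fact p.Prime]

/-- **LEVEL `0` ∧ `#R_str(Φ) ≥ p` ⟹ `Ш(W/ℚ)[p] ≠ 0` ON THE CM-RAMIFIED CLASS — NO case hypothesis, NO alignment, NO named fact.**
`W/ℚ` globally minimal with CM, `p ≥ 5` ramified in the CM field, `v ∋ p`; `Φ ≤ W[p]` a stable line of order `p`; `P ∈ W(ℚ)` with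
`W(ℚ) = ℤ•P + torsion` and LEVEL `0` at `p` (`p • Q ≠ P` in `W(ℚ_p)` — the NEGATION of the premise of registry v21's `stub_bsdp_of_level`);
and `p ≤ #(h1Unramified Φ.Sub S_p ⊓ ker res_{D_p})` (at least `p` STRICT residual classes). THEN `∃ c ∈ Ш(W/ℚ), c ≠ 0 ∧ p • c = 0`.
Class inputs: `Φ.Quot^Γ = 0` (inertia homothety, `LevelDictionaryAlpha.quot_eq_zero_of_forall_inertia_smul_eq_at_p`), `W(ℚ_ℓ)[p] = 0` at bad
`ℓ ≠ p` (`forall_prime_nsmul_eq_zero_adicCompletion_of_bad`), rational torsion `p`-divisible (w6 g4 `exists_eq_nsmul_of_isOfFinAddOrder_of_cmRamified`),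
`ℚ_v = ℚ_p` currency (w6 g4 `forall_nsmul_ne_baseChange_of_level_zero`), `#Sel_p < ∞`. READING: with `Φ = 𝔽_p(ψ)` and `#R_str(ψ) ≥ p` on
EVEN-IRREGULAR members (reflection supply p684559 and `#R_rel/#R_str ≤ #H¹(ℚ_p, 𝔽_p(ψ)) = p`): **EVEN-IRREGULAR ∧ LEVEL 0 ⟹ B1-sha's premise**,
so every even-irregular rank-one member is in the premise of `stub_bsdp_of_level` or of `stub_bsdp_of_sha`.
[cite: SilvermanAEC2009, Thm. X.4.2 (a)] [cite: GrossLMS1991, §9] -/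
theorem exists_sha_ne_zero_of_level_zero_of_prime_le_strict_of_cmRamified
    (hCM : W.HasCM) (hram : CMRamified W p) (h5 : 5 ≤ p)
    {v : HeightOneSpectrum (𝓞 ℚ)} (hpv : ((p : ℕ) : 𝓞 ℚ) ∈ v.asIdeal)
    (Φ : StableSubgroup (absoluteGaloisGroup ℚ) (geomTorsion W (p : ℤ))) (hcard : Nat.card Φ.Sub = p)
    (P : W.toAffine.Point)
    (hgen : ∀ R : W.toAffine.Point, ∃ (k : ℤ) (T : W.toAffine.Point), IsOfFinAddOrder T ∧ R = k • P + T)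
    (hlev : ∀ Q : (W.baseChange ℚ_[p]).toAffine.Point, p • Q ≠ W.toPadicPoint p P)
    (hle : p ≤ Nat.card ↥(h1Unramified Φ.Sub {v' : HeightOneSpectrum (𝓞 ℚ) | ((p : ℕ) : 𝓞 ℚ) ∈ v'.asIdeal} ⊓
        subgroupResKer Φ.Sub (decomp v))) :
    ∃ c ∈ W.sha, c ≠ 0 ∧ p • c = 0 := by
  have hpr : p.Prime := hp.out
  have hp2 : p ≠ 2 := by omega
  have hp0 : ((p : ℕ) : ℤ) ≠ 0 := by exact_mod_cast hpr.ne_zero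
  -- class inputs
  have hQΓ : ∀ q : Φ.Quot, (∀ g : absoluteGaloisGroup ℚ, g • q = q) → q = 0 := fun q hq ↦
    LevelDictionaryAlpha.quot_eq_zero_of_forall_inertia_smul_eq_at_p W Φ hCM h5 hram hcard hpv
      (adicCompletionPrime_mem_primesAbove ℚ v) q fun g _ ↦ hq g
  have hbad : ∀ v' : HeightOneSpectrum (𝓞 ℚ), ¬ W.HasGoodReductionAt v' → ((p : ℕ) : 𝓞 ℚ) ∉ v'.asIdeal →
      ∀ Q : (W.baseChange (v'.adicCompletion ℚ)).toAffine.Point, p • Q = 0 → Q = 0 :=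
    fun v' hg hpv' ↦ LevelDictionaryAlpha.forall_prime_nsmul_eq_zero_adicCompletion_of_bad (K := ℚ) W hCM hram h5 hpv' hg
  have htorsdiv : ∀ T : W.toAffine.Point, IsOfFinAddOrder T → ∃ T' : W.toAffine.Point, T = p • T' :=
    fun T hT ↦ exists_eq_nsmul_of_isOfFinAddOrder_of_cmRamified W hCM h5 hram hpv hT
  have hlev' := forall_nsmul_ne_baseChange_of_level_zero W v hpv P hlev
  -- finiteness of `T(Sel_p)`
  haveI : Finite (selmerGroup W (p : ℤ)) := W.finite_selmerGroup_holds hp0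
  haveI : Finite ↥((selmerGroup W (p : ℤ)).map (W.torsionH1ToH1 (p : ℤ))) :=
    Finite.of_surjective (fun x : selmerGroup W (p : ℤ) ↦
      (⟨W.torsionH1ToH1 (p : ℤ) x, AddSubgroup.mem_map_of_mem _ x.2⟩ : ↥((selmerGroup W (p : ℤ)).map (W.torsionH1ToH1 (p : ℤ)))))
      fun y ↦ by
        obtain ⟨x, hx, hxy⟩ := AddSubgroup.mem_map.1 y.2
        exact ⟨⟨x, hx⟩, Subtype.ext hxy⟩
  -- the count of §2, read on `Ш(W) ∩ H¹(ℚ,W)[p]`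
  have hN := hle.trans (natCard_strict_le_natCard_map_selmerGroup_of_level_zero W Φ hp2 hQΓ hbad hpv P hgen htorsdiv hlev')
  rw [WeierstrassCurve.map_torsionH1ToH1_selmerGroup_holds W hp0] at hN
  have hsha : 1 < Nat.card (W.sha ⊓ AddSubgroup.torsionBy W.galH1 p : AddSubgroup W.galH1) := hpr.one_lt.trans_le hN
  haveI : Finite (W.sha ⊓ AddSubgroup.torsionBy W.galH1 p : AddSubgroup W.galH1) := Nat.finite_of_card_ne_zero (by omega)
  obtain ⟨x, y, hxy⟩ := Finite.one_lt_card_iff_nontrivial.mp hsha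
  have hx : ∃ z : (W.sha ⊓ AddSubgroup.torsionBy W.galH1 p : AddSubgroup W.galH1), z ≠ 0 := by
    by_cases h : x = 0
    · exact ⟨y, fun hy ↦ hxy (h.trans hy.symm)⟩
    · exact ⟨x, h⟩
  obtain ⟨z, hz⟩ := hx
  obtain ⟨hzsha, hztor⟩ := AddSubgroup.mem_inf.mp z.2
  exact ⟨z.1, hzsha, fun h ↦ hz (Subtype.ext h), AddSubgroup.torsionBy.nsmul_iff.mp hztor⟩

end Class

end Summit.BirchSwinnertonDyer.BirchSwinnertonDyer.Theorems.PrintCFram.SelmerCount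

end
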